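import Summits.Ventures.HSemireg.WedgeHankelRecurrenceGaussNewtonConvergence

/-!
# Venture HSemireg — **UNIQUENESS OF THE GAUSS–LOBATTO RULE: THE INTERIOR NODES ARE FORCED**: any rule `λ_c δ_c + λ_d δ_d + Σ λ_l δ_{w_l}` with `t + 1` free nodes that is exact to degree
# `2t + 3` for a discrete measure `M` on nodes `V` has `∏ (X − w_k)` ORTHOGONAL to all polynomials of degree `≤ t` for the modified measure `(V − c)(d − V)·M`; hence (for the support inside
# `(c, d)`) it is the Gauss node polynomial of that measure — the rule CONSTRUCTED in N278 — and two such rules have the same free nodes (the two-end analogue of N343)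

HONEST FRAMING. Part of the Lean index of the computation cell `pub-hsemireg` (seat p10 gen 45, Sunday typer «UNIFORM-IN-n»).  Real polynomials and finite sums only; no variety, no cohomology
theory, no sheaf, no Ext group and no semiregularity map is constructed here; nothing here says that HC / HC_CM / HC_AV holds; no Literature fact (unproved `Prop`) is declared or used.  Custodian
versions as in `WedgeHankelSiegelIdeal` (1/3).
SOURCES (cited).  R. Lobatto, *Lessen over de Differentiaal- en Integraal-Rekening* II (1852) §207; W. Gautschi, *Orthogonal Polynomials: Computation and Approximation* (2004) §1.4.2, Thm 1.49 ∕
(1.4.21) (Gauss–Lobatto: the free nodes are the zeros of `π_n(·; (t − a)(b − t)dλ)`); P. J. Davis, P. Rabinowitz, *Methods of Numerical Integration* (2nd ed.) §2.7.1; G. H. Golub, *Some modified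
matrix eigenvalue problems*, SIAM Rev. 15 (1973) 318–334, §7.
PROOF TYPED HERE.  Exactness applied to `F = (X − c)(X − d)·∏(X − w_k)·G` (degree `≤ 2t + 3`; N278 `lobatto_eval_eq_of_exact`), which vanishes at every node of the rule, so
`Σ M (V − c)(V − d)(∏ G)(V) = 0`; uniqueness of the monic orthogonal polynomial for the positive measure `(V − c)(d − V)M` (N290); identification with N278 via N265
`sum_mul_eval_nodePoly_mul_eq_zero`.
DEDUP DISCLOSURE (`rg -n 'lobatto' Summits/Ventures/HSemireg`, 2026-09-03): N278 CONSTRUCTS the Lobatto rule (existence, exactness, positivity, nodes in `(c, d)`); N343 is the Radau converse; the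
Lobatto converse is new.  The 3 names below: 0 hits tree-wide.

WHAT IS IN THE TREE.  N278 `lobatto_eval_eq_of_exact`, `gauss_lobatto`; N290 `orthogonal_monic_unique`; N265 `sum_mul_eval_nodePoly_mul_eq_zero`; N343 (Radau analogue).
THIS FILE (namespace `Summit.Ventures.HSemireg.Wedge.HankelOuter` continued; CHAINED on N350 (import only); 0 definitions):
* §1116 **`lobatto_interior_orthogonal`** (exactness to degree `2t + 3` with the nodes `c, d` ⇒ `∏(X − w_k) ⟂ G` for `(V − c)(d − V)M`, `deg G ≤ t`), **`lobatto_interior_unique`** (two such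
  rules for a measure carried by `(c, d)` have the same `∏(X − w_k)`), **`lobatto_interior_eq_gauss_modified`** (it is the Gauss node polynomial of `(V − c)(d − V)M`).
CAVEATS.  Discrete positive measures; for the uniqueness `c < V_l < d` for all `l` and `t + 1 ≤ P`; the weights are not discussed (they follow from the nodes by Lagrange interpolation).
Nothing Ext-side.  New names only.
-/

open Module Polynomial
open scoped Matrix Polynomial

namespace Summit.Ventures.HSemireg.Wedge.HankelOuter

/-! ## §1116. Uniqueness of the Gauss–Lobatto rule -/

/-- **A rule `λ_c δ_c + λ_d δ_d + Σ λ_l δ_{w_l}` (`t + 1` free nodes) exact to degree `2t + 3` has `∏(X − w_k)` orthogonal to degree `≤ t` for `(V − c)(d − V)·M`.** [Gautschi Thm 1.49;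
this file, §1116] -/
theorem lobatto_interior_orthogonal {t P : ℕ} {M V : Fin P → ℝ} {c d lc ld : ℝ} {lam w : Fin (t + 1) → ℝ}
    (hex : ∀ p, p ≤ 2 * t + 3 → lc * c ^ p + ld * d ^ p + ∑ l, lam l * w l ^ p = ∑ l, M l * V l ^ p) {G : ℝ[X]} (hG : G.natDegree ≤ t) :
    ∑ l, (M l * ((V l - c) * (d - V l))) * ((∏ k, (Polynomial.X - C (w k))) * G).eval (V l) = 0 := by
  obtain ⟨F, hF⟩ : ∃ F : ℝ[X], F = (Polynomial.X - C c) * (Polynomial.X - C d) * ((∏ k, (Polynomial.X - C (w k))) * G) := ⟨_, rfl⟩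
  have hPi : (∏ k, (Polynomial.X - C (w k))).natDegree = t + 1 := by
    rw [natDegree_prod_of_monic _ _ (fun k _ => monic_X_sub_C _)]
    simp only [natDegree_X_sub_C, Finset.sum_const, Finset.card_univ, Fintype.card_fin, smul_eq_mul, mul_one]
  have hFd : F.natDegree ≤ 2 * t + 3 := by
    rw [hF]
    refine natDegree_mul_le.trans ?_
    refine (add_le_add (natDegree_mul_le.trans (add_le_add (natDegree_X_sub_C c).le (natDegree_X_sub_C d).le)) (natDegree_mul_le.trans (add_le_add hPi.le hG))).trans ?_
    omega
  have h := lobatto_eval_eq_of_exact hex hFd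
  -- `F` vanishes at every node of the rule
  have hc0 : F.eval c = 0 := by rw [hF]; simp only [eval_mul, eval_sub, eval_X, eval_C, sub_self, zero_mul]
  have hd0 : F.eval d = 0 := by rw [hF]; simp only [eval_mul, eval_sub, eval_X, eval_C, sub_self, mul_zero, zero_mul]
  have hw0 : ∀ l, F.eval (w l) = 0 := fun l => by
    rw [hF]
    simp only [eval_mul, eval_prod]
    rw [Finset.prod_eq_zero (Finset.mem_univ l) (by rw [eval_sub, eval_X, eval_C, sub_self])]
    ring
  rw [hc0, hd0, mul_zero, mul_zero, zero_add, zero_add, Finset.sum_eq_zero (fun l _ => by rw [hw0 l, mul_zero])] at h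
  -- the right side is minus the target sum
  have hneg : ∑ l, (M l * ((V l - c) * (d - V l))) * ((∏ k, (Polynomial.X - C (w k))) * G).eval (V l) = -∑ l, M l * F.eval (V l) := by
    rw [← Finset.sum_neg_distrib]
    refine Finset.sum_congr rfl fun l _ => ?_
    rw [hF]
    simp only [eval_mul, eval_sub, eval_X, eval_C]
    ring
  rw [hneg, ← h, neg_zero]

/-- **UNIQUENESS OF THE LOBATTO INTERIOR NODES: two rules through the same `c, d` with `c < V_l < d`, both exact to degree `2t + 3`, have the same `∏(X − w_k)`.** [Lobatto 1852; Gautschi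
§1.4.2; this file, §1116] -/
theorem lobatto_interior_unique {t P : ℕ} {M V : Fin P → ℝ} (hM : ∀ l, 0 < M l) (hV : Function.Injective V) (hP : t + 1 ≤ P) {c d : ℝ} (hcV : ∀ l, c < V l) (hVd : ∀ l, V l < d)
    {lc ld lc' ld' : ℝ} {lam w lam' w' : Fin (t + 1) → ℝ}
    (hex : ∀ p, p ≤ 2 * t + 3 → lc * c ^ p + ld * d ^ p + ∑ l, lam l * w l ^ p = ∑ l, M l * V l ^ p)
    (hex' : ∀ p, p ≤ 2 * t + 3 → lc' * c ^ p + ld' * d ^ p + ∑ l, lam' l * w' l ^ p = ∑ l, M l * V l ^ p) :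
    ∏ k, (Polynomial.X - C (w k)) = ∏ k, (Polynomial.X - C (w' k)) := by
  have hdeg : ∀ u : Fin (t + 1) → ℝ, (∏ k, (Polynomial.X - C (u k))).natDegree = t + 1 := fun u => by
    rw [natDegree_prod_of_monic _ _ (fun k _ => monic_X_sub_C _)]
    simp only [natDegree_X_sub_C, Finset.sum_const, Finset.card_univ, Fintype.card_fin, smul_eq_mul, mul_one]
  exact orthogonal_monic_unique (ν := fun l => M l * ((V l - c) * (d - V l))) (fun l => mul_pos (hM l) (mul_pos (sub_pos.2 (hcV l)) (sub_pos.2 (hVd l)))) hV hP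
    (monic_prod_of_monic _ _ fun k _ => monic_X_sub_C _) (hdeg w) (monic_prod_of_monic _ _ fun k _ => monic_X_sub_C _) (hdeg w')
    (fun G hG => lobatto_interior_orthogonal hex (by omega)) (fun G hG => lobatto_interior_orthogonal hex' (by omega))

/-- **THE LOBATTO INTERIOR NODES ARE THE GAUSS NODES OF `(V − c)(d − V)·M`**: if `(ν', w')` is the `(t+1)`-point Gauss rule of the modified measure (as in N278) then any exact rule through `c, d`
with `t + 1` free nodes has `∏(X − w_k) = ∏(X − w'_k)`. [Gautschi (1.4.21); Golub 1973 §7; this file, §1116] -/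
theorem lobatto_interior_eq_gauss_modified {t P : ℕ} {M V : Fin P → ℝ} (hM : ∀ l, 0 < M l) (hV : Function.Injective V) (hP : t + 1 ≤ P) {c d : ℝ} (hcV : ∀ l, c < V l) (hVd : ∀ l, V l < d)
    {ν' w' : Fin (t + 1) → ℝ} (hB : ∀ p, p ≤ 2 * t + 1 → ∑ l, ν' l * w' l ^ p = ∑ l, (M l * ((V l - c) * (d - V l))) * V l ^ p)
    {lc ld : ℝ} {lam w : Fin (t + 1) → ℝ} (hex : ∀ p, p ≤ 2 * t + 3 → lc * c ^ p + ld * d ^ p + ∑ l, lam l * w l ^ p = ∑ l, M l * V l ^ p) :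
    ∏ k, (Polynomial.X - C (w k)) = ∏ k, (Polynomial.X - C (w' k)) := by
  have hdeg : ∀ u : Fin (t + 1) → ℝ, (∏ k, (Polynomial.X - C (u k))).natDegree = t + 1 := fun u => by
    rw [natDegree_prod_of_monic _ _ (fun k _ => monic_X_sub_C _)]
    simp only [natDegree_X_sub_C, Finset.sum_const, Finset.card_univ, Fintype.card_fin, smul_eq_mul, mul_one]
  exact orthogonal_monic_unique (ν := fun l => M l * ((V l - c) * (d - V l))) (fun l => mul_pos (hM l) (mul_pos (sub_pos.2 (hcV l)) (sub_pos.2 (hVd l)))) hV hP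
    (monic_prod_of_monic _ _ fun k _ => monic_X_sub_C _) (hdeg w) (monic_prod_of_monic _ _ fun k _ => monic_X_sub_C _) (hdeg w')
    (fun G hG => lobatto_interior_orthogonal hex (by omega)) (fun G hG => sum_mul_eval_nodePoly_mul_eq_zero hB (by omega))

end Summit.Ventures.HSemireg.Wedge.HankelOuter
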